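import Summits.HodgeConjecture.HodgeConjecture.Theorems.F0P3cStCharTSKormanRemarkEight     -- ★ row 25 §1 `char_eq_trace_fixedPoints_of_constOn_coset` (`𝔇.char`∕`hrep` letters); brings `Gqs`, `EllipticData`, `isAdmissible_smoothIrrep`, TRACE-COSET
import Summits.HodgeConjecture.HodgeConjecture.Theorems.F0P3cStCharTSEPGlueGExplicit         -- ★ (G3)-EXPLICIT letters `(w hw ϖ hd eA heA)`: `galAdicCompletionMap`, `localNonsplitEquiv`, `Gqs L v ≃ₜ* ↥(unitaryGroupOfForm …)`
import Literature.NumberTheory.Automorphic.SchneiderStuhlerCharacterElliptic              -- ★ 41f FILE B2 (F0P3a-p04 g31): `Representation.levelTrace_eq_fixedVertexSum_sub_fixedEdgeSum` (the generic (SS-K) uniform head)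
import Literature.NumberTheory.Automorphic.SmoothFixedVectorFiniteCarrier                  -- ★ 41c (LH5-p02): `exists_finset_fixedPoints_le_biSup_of_isAdmissible`, `Subgroup.exists_aux_subgroup_of_eventually_eq_finset`
import Literature.NumberTheory.Automorphic.SmoothFixedVectorGeneration                     -- ★ row 23 (LH5-p02): `iSup_fixedPoints_map_conj_eq_top`
import Literature.NumberTheory.Automorphic.UnitaryLatticeTreeValencyInertPlace             -- ★ `finite_neighborSet_inert` (local finiteness of the tree at an inert place)
import Literature.NumberTheory.Automorphic.CMPrincipalSeriesJacquetEvalOne                 -- ★ `nonarchimedeanGroup_unitaryGroupOfForm_local`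
import Literature.NumberTheory.Automorphic.AdicCompletionCompact                           -- ★ `compactSpace_integer_adicCompletion`
import Literature.NumberTheory.Automorphic.UnitaryLatticeTreeLevelGroupsPackage               -- ★ 41g FILE P (this seat): the (U)-column packaged in `↥(unitaryGroupOfForm σ H)`
import HarnessLib

/-!
# (SS-K) UNIFORM AT THE DATUM — E1 row 41g, FILE H (transport of the tree letters to `Gqs L v` along the (G3) iso `eA`; the HEAD follows ★ 41f FILE B2)

Cell `pub/hodgecm-mathlib`, crux H413 = `stmt-HodgeConjecture-24833` (`--supports` lane, helper, THEOREMS ONLY: no definition ∕ instance ∕ notation ∕ named fact ∕ `sorry`).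
Namespace `Summit.HodgeConjecture.HodgeConjecture.Cruxes.H413.F0P3cStCharTSCharacterEllipticUniform`.  E1 BRICK LEDGER row 41g «(SS-K) UNIFORM @ DATUM» (keeper F0P3a-p03 (g29)
02:06:13Z → LH6-p04 (g11); sigsheet SIG-R41G v1 b96b08c7 «=» 02:11:49Z).  HONEST LABEL: count-neutral helper; (R-SS) NOT chartered; E1 = PRINT until the keeper's charter test;
HC_CM is proved only modulo the 7 printed citations (2 remaining named inputs hLiu418 = stmt-HodgeConjecture-24832, h413 = stmt-HodgeConjecture-24833) until rung 0 closes.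

* §1 TRANSPORT ALONG A `≃ₜ*` (generic): pull-backs of subgroups along a topological-group isomorphism keep openness, compactness, `⊔`, set products, product inclusions and
  conjugates — the bookkeeping that moves ★ FILE P's statements from `↥(unitaryGroupOfForm σK Φ₃)` to `Gqs L v` along the (G3) iso `eA`.
* §2 THE TREE LETTERS AT THE DATUM (∃-suppliers, q1 ruling): from `(w hw ϖ hd eA)` alone, the action hom `a : Gqs L v →* (G ≃g G)` and the unitary level family
  `U : 𝓥 → Subgroup (Gqs L v)` at level `ϖ^(e+1)` with ALL of 41f's tree-side hypotheses: `hstab`, `hUo`, `hUc`, `hU6`, `hU7` (★ δ), `hUa`, `hEo`, `hEc`, level ≥ 1 fixes the closed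
  star, normalisers, finite fixed edges.

## References
* [SchneiderStuhler1997] P. Schneider, U. Stuhler, *Representation theory and sheaves on the Bruhat–Tits building*, Publ. Math. IHÉS 85 (1997): Ch. I §2, Prop. I.3.1, Thm. III.4.16.
* [Korman2004] J. Korman, *On the local constancy of characters*, arXiv:math/0409292: §3.6, §9 Claim 39, Thm. 40.
* [MeyerSolleveld2010] R. Meyer, M. Solleveld, *Resolutions for representations of reductive p-adic groups via their buildings*, Crelle 647 (2010): Prop. 4.1.
* [Rogawski1990] J. D. Rogawski, *Automorphic Representations of Unitary Groups in Three Variables* (1990): §12.5 pp. 182–187.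
-/

set_option autoImplicit false

set_option linter.dupNamespace false

noncomputable section

open NumberField IsDedekindDomain MeasureTheory
open scoped Pointwise Valued WithZero
open Literature.NumberTheory.Rogawski1990 Literature.NumberTheory.Rogawski1990.Ch12Sec5
open Literature.NumberTheory.Automorphic Literature.NumberTheory.Automorphic.UnitaryGroup Literature.NumberTheory.Automorphic.UnitaryLatticeTree
open Literature.NumberTheory.Automorphic.HermitianLattice
open Literature.Combinatorics.SimpleGraph Literature.Combinatorics.SimpleGraph.OrientedIncidence

namespace Summit.HodgeConjecture.HodgeConjecture.Cruxes.H413.F0P3cStCharTSCharacterEllipticUniform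

open Summit.HodgeConjecture.HodgeConjecture.Cruxes.H413

/-! ## §1 Transport along a topological-group isomorphism -/

section Transport

variable {Γ Γ₀ : Type*} [Group Γ] [Group Γ₀] [TopologicalSpace Γ] [TopologicalSpace Γ₀] (e : Γ ≃ₜ* Γ₀)

/-- Membership in a pull-back along `e`. [cite: SchneiderStuhler1997, Ch. I §2] -/
theorem mem_comap_iff' (S : Subgroup Γ₀) (x : Γ) : x ∈ S.comap e.toMonoidHom ↔ e x ∈ S := Iff.rfl

/-- Pull-back of an open subgroup along `e` is open. [cite: SchneiderStuhler1997, Ch. I §2 (U1)] -/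
theorem isOpen_coe_comap (S : Subgroup Γ₀) (hS : IsOpen (S : Set Γ₀)) : IsOpen ((S.comap e.toMonoidHom : Subgroup Γ) : Set Γ) :=
  hS.preimage e.continuous

/-- Pull-back of a compact subgroup along `e` is compact. [cite: SchneiderStuhler1997, Ch. I §2 (U1)] -/
theorem isCompact_coe_comap (S : Subgroup Γ₀) (hS : IsCompact (S : Set Γ₀)) : IsCompact ((S.comap e.toMonoidHom : Subgroup Γ) : Set Γ) := by
  have h : ((S.comap e.toMonoidHom : Subgroup Γ) : Set Γ) = e.toHomeomorph ⁻¹' (S : Set Γ₀) := rfl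
  rw [h, e.toHomeomorph.isCompact_preimage]
  exact hS

/-- Preimage of a set product along `e` is the product of the preimages. [cite: SchneiderStuhler1997, Prop. I.3.1] -/
theorem preimage_mul (A B : Set Γ₀) : (e : Γ → Γ₀) ⁻¹' (A * B) = (e : Γ → Γ₀) ⁻¹' A * (e : Γ → Γ₀) ⁻¹' B := by
  ext x
  constructor
  · rintro ⟨a, ha, b, hb, hab⟩
    refine Set.mem_mul.2 ⟨e.symm a, ?_, e.symm b, ?_, ?_⟩
    · change e (e.symm a) ∈ A; rwa [e.apply_symm_apply]
    · change e (e.symm b) ∈ B; rwa [e.apply_symm_apply]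
    · apply e.injective
      rw [map_mul, e.apply_symm_apply, e.apply_symm_apply]
      exact hab
  · rintro ⟨a, ha, b, hb, rfl⟩
    exact ⟨e a, ha, e b, hb, (map_mul e a b).symm⟩

/-- The pull-back of a sup along `e` has carrier the product of the pull-backs, when the sup upstairs is a product ((U6) transports).
[cite: SchneiderStuhler1997, Ch. I §2 (U6)] -/
theorem coe_sup_comap_eq_mul {A B : Subgroup Γ₀} (h : ((A ⊔ B : Subgroup Γ₀) : Set Γ₀) = (A : Set Γ₀) * (B : Set Γ₀)) :
    ((A.comap e.toMonoidHom ⊔ B.comap e.toMonoidHom : Subgroup Γ) : Set Γ) = (A.comap e.toMonoidHom : Set Γ) * (B.comap e.toMonoidHom : Set Γ) := by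
  have h1 : (((A ⊔ B).comap e.toMonoidHom : Subgroup Γ) : Set Γ) = (A.comap e.toMonoidHom : Set Γ) * (B.comap e.toMonoidHom : Set Γ) := by
    change (e : Γ → Γ₀) ⁻¹' ((A ⊔ B : Subgroup Γ₀) : Set Γ₀) = (e : Γ → Γ₀) ⁻¹' (A : Set Γ₀) * (e : Γ → Γ₀) ⁻¹' (B : Set Γ₀)
    rw [h, preimage_mul]
  have h2 : A.comap e.toMonoidHom ⊔ B.comap e.toMonoidHom = (A ⊔ B).comap e.toMonoidHom := by
    refine le_antisymm (sup_le (Subgroup.comap_mono le_sup_left) (Subgroup.comap_mono le_sup_right)) fun x hx => ?_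
    have hx' : x ∈ (((A ⊔ B).comap e.toMonoidHom : Subgroup Γ) : Set Γ) := hx
    rw [h1] at hx'
    obtain ⟨a, ha, b, hb, rfl⟩ := Set.mem_mul.1 hx'
    exact Subgroup.mul_mem_sup ha hb
  rw [h2, h1]

/-- A product inclusion transports along `e` ((U7) transports). [cite: SchneiderStuhler1997, Prop. I.3.1] -/
theorem coe_comap_subset_mul {A B C : Subgroup Γ₀} (h : (B : Set Γ₀) ⊆ (A : Set Γ₀) * (C : Set Γ₀)) :
    ((B.comap e.toMonoidHom : Subgroup Γ) : Set Γ) ⊆ (A.comap e.toMonoidHom : Set Γ) * (C.comap e.toMonoidHom : Set Γ) := by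
  change (e : Γ → Γ₀) ⁻¹' (B : Set Γ₀) ⊆ (e : Γ → Γ₀) ⁻¹' (A : Set Γ₀) * (e : Γ → Γ₀) ⁻¹' (C : Set Γ₀)
  rw [← preimage_mul]
  exact Set.preimage_mono h

/-- Conjugates transport: `(S.map (conj (e g))).comap e = (S.comap e).map (conj g)`. [cite: SchneiderStuhler1997, Ch. I §2 (U3)] -/
theorem comap_map_conj (S : Subgroup Γ₀) (g : Γ) :
    (S.map (MulAut.conj (e g)).toMonoidHom).comap e.toMonoidHom = (S.comap e.toMonoidHom).map (MulAut.conj g).toMonoidHom := by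
  ext x
  rw [mem_comap_iff', Subgroup.mem_map_equiv, Subgroup.mem_map_equiv, mem_comap_iff', MulAut.conj_symm_apply, MulAut.conj_symm_apply, map_mul, map_mul, map_inv]

/-- Normalisers transport: `e g ∈ N(S) ⇒ g ∈ N(S.comap e)`. [cite: SchneiderStuhler1997, Ch. I §2 (U3)] -/
theorem mem_normalizer_comap {S : Subgroup Γ₀} {g : Γ} (h : e g ∈ Subgroup.normalizer (S : Set Γ₀)) :
    g ∈ Subgroup.normalizer ((S.comap e.toMonoidHom : Subgroup Γ) : Set Γ) := by
  rw [Subgroup.mem_normalizer_iff] at h ⊢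
  intro x
  rw [mem_comap_iff', mem_comap_iff', map_mul, map_mul, map_inv]
  exact h (e x)

end Transport

/-! ## §2 The tree letters at the datum: the action hom and the unitary level family on `Gqs L v` (hypothesis-style `ha`, `hU`), their supplier, and 41f's tree-side hypotheses -/

section Datum

variable (L : Type) [Field L] [NumberField L] [IsCMField L] (v : HeightOneSpectrum (𝓞 ↥(maximalRealSubfield L)))
  (w : PlacesOver L v) (hw : IsCMField.complexConj L • w.1 = w.1) {ϖ : w.1.adicCompletion L}
  (eA : Gqs L v ≃ₜ* ↥(unitaryGroupOfForm (galAdicCompletionMap (L := L) (IsCMField.complexConj L) hw) ((StdForm.antidiagonal 3).over (w.1.adicCompletion L))))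

/-- **SUPPLIER**: the action hom `a = latticeGraphIso ∘ eA` and the unitary level family `U x = eA⁻¹(U⁰_x)` at level `ϖ^(e+1)` exist (★ FILE P `exists_monoidHom_latticeGraphIso`,
`exists_unitaryLevelFamily`, pulled back along `eA`). [cite: SchneiderStuhler1997, Ch. I §2 (U1)] [cite: Rogawski1990, §12.5 pp. 182–187] -/
theorem exists_actionHom_unitaryLevelFamily (e : ℕ) :
    ∃ (a : Gqs L v →* ((latticeGraph (galAdicCompletionMap (L := L) (IsCMField.complexConj L) hw) ϖ ((StdForm.antidiagonal 3).over (w.1.adicCompletion L))) ≃g (latticeGraph (galAdicCompletionMap (L := L) (IsCMField.complexConj L) hw) ϖ ((StdForm.antidiagonal 3).over (w.1.adicCompletion L))))) (U : {M : Submodule 𝒪[(w.1.adicCompletion L)] (Fin 3 → (w.1.adicCompletion L)) // IsVertex (galAdicCompletionMap (L := L) (IsCMField.complexConj L) hw) ϖ ((StdForm.antidiagonal 3).over (w.1.adicCompletion L)) M} → Subgroup (Gqs L v)),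
      (∀ g, a g = latticeGraphIso (galAdicCompletionMap (L := L) (IsCMField.complexConj L) hw) ϖ ((StdForm.antidiagonal 3).over (w.1.adicCompletion L)) (eA g)) ∧
      ∀ x g, g ∈ U x ↔ mapGL ((eA g : ↥(unitaryGroupOfForm (galAdicCompletionMap (L := L) (IsCMField.complexConj L) hw) ((StdForm.antidiagonal 3).over (w.1.adicCompletion L)))) : GL (Fin 3) (w.1.adicCompletion L)) x.1 = x.1 ∧
        x.1.map ((Matrix.toLin' ((((eA g : ↥(unitaryGroupOfForm (galAdicCompletionMap (L := L) (IsCMField.complexConj L) hw) ((StdForm.antidiagonal 3).over (w.1.adicCompletion L)))) : GL (Fin 3) (w.1.adicCompletion L)) : Matrix (Fin 3) (Fin 3) (w.1.adicCompletion L)) - 1)).restrictScalars 𝒪[(w.1.adicCompletion L)]) ≤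
          scaleLattice (ϖ ^ (e + 1)) x.1 := by
  obtain ⟨a₀, ha₀⟩ := exists_monoidHom_latticeGraphIso (galAdicCompletionMap (L := L) (IsCMField.complexConj L) hw) ϖ ((StdForm.antidiagonal 3).over (w.1.adicCompletion L))
  obtain ⟨U₀, hU₀⟩ := exists_unitaryLevelFamily (galAdicCompletionMap (L := L) (IsCMField.complexConj L) hw) ϖ ((StdForm.antidiagonal 3).over (w.1.adicCompletion L)) (ϖ ^ (e + 1))
  exact ⟨a₀.comp eA.toMonoidHom, fun x => (U₀ x).comap eA.toMonoidHom, fun g => ha₀ (eA g), fun x g => (mem_comap_iff' eA (U₀ x) g).trans (hU₀ x (eA g))⟩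

variable {L v w hw eA}
variable {a : Gqs L v →* ((latticeGraph (galAdicCompletionMap (L := L) (IsCMField.complexConj L) hw) ϖ ((StdForm.antidiagonal 3).over (w.1.adicCompletion L))) ≃g (latticeGraph (galAdicCompletionMap (L := L) (IsCMField.complexConj L) hw) ϖ ((StdForm.antidiagonal 3).over (w.1.adicCompletion L))))} (ha : ∀ g, a g = latticeGraphIso (galAdicCompletionMap (L := L) (IsCMField.complexConj L) hw) ϖ ((StdForm.antidiagonal 3).over (w.1.adicCompletion L)) (eA g))
  {e : ℕ} {U : {M : Submodule 𝒪[(w.1.adicCompletion L)] (Fin 3 → (w.1.adicCompletion L)) // IsVertex (galAdicCompletionMap (L := L) (IsCMField.complexConj L) hw) ϖ ((StdForm.antidiagonal 3).over (w.1.adicCompletion L)) M} → Subgroup (Gqs L v)}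
  (hU : ∀ x g, g ∈ U x ↔ mapGL ((eA g : ↥(unitaryGroupOfForm (galAdicCompletionMap (L := L) (IsCMField.complexConj L) hw) ((StdForm.antidiagonal 3).over (w.1.adicCompletion L)))) : GL (Fin 3) (w.1.adicCompletion L)) x.1 = x.1 ∧
    x.1.map ((Matrix.toLin' ((((eA g : ↥(unitaryGroupOfForm (galAdicCompletionMap (L := L) (IsCMField.complexConj L) hw) ((StdForm.antidiagonal 3).over (w.1.adicCompletion L)))) : GL (Fin 3) (w.1.adicCompletion L)) : Matrix (Fin 3) (Fin 3) (w.1.adicCompletion L)) - 1)).restrictScalars 𝒪[(w.1.adicCompletion L)]) ≤ scaleLattice (ϖ ^ (e + 1)) x.1)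

include hU in
/-- The pushed-forward family `U⁰ x := (U x).map eA` is the unitary level family upstairs (rows 22∕22b∕δ letters). [cite: SchneiderStuhler1997, Ch. I §2 (U1)] -/
theorem map_unitaryLevel_mem_iff (x : {M : Submodule 𝒪[(w.1.adicCompletion L)] (Fin 3 → (w.1.adicCompletion L)) // IsVertex (galAdicCompletionMap (L := L) (IsCMField.complexConj L) hw) ϖ ((StdForm.antidiagonal 3).over (w.1.adicCompletion L)) M}) (u : ↥(unitaryGroupOfForm (galAdicCompletionMap (L := L) (IsCMField.complexConj L) hw) ((StdForm.antidiagonal 3).over (w.1.adicCompletion L)))) :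
    u ∈ (U x).map eA.toMonoidHom ↔ mapGL (u : GL (Fin 3) (w.1.adicCompletion L)) x.1 = x.1 ∧
      x.1.map ((Matrix.toLin' (((u : GL (Fin 3) (w.1.adicCompletion L)) : Matrix (Fin 3) (Fin 3) (w.1.adicCompletion L)) - 1)).restrictScalars 𝒪[(w.1.adicCompletion L)]) ≤ scaleLattice (ϖ ^ (e + 1)) x.1 := by
  rw [Subgroup.mem_map_equiv]
  change eA.symm u ∈ U x ↔ _
  rw [hU, ContinuousMulEquiv.apply_symm_apply]

/-- `U x` is the pull-back of its push-forward along `eA`. [cite: SchneiderStuhler1997, Ch. I §2 (U1)] -/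
theorem unitaryLevel_eq_comap_map (x : {M : Submodule 𝒪[(w.1.adicCompletion L)] (Fin 3 → (w.1.adicCompletion L)) // IsVertex (galAdicCompletionMap (L := L) (IsCMField.complexConj L) hw) ϖ ((StdForm.antidiagonal 3).over (w.1.adicCompletion L)) M}) : U x = ((U x).map eA.toMonoidHom).comap eA.toMonoidHom := by
  ext g
  rw [mem_comap_iff', Subgroup.mem_map_equiv]
  change _ ↔ eA.symm (eA g) ∈ U x
  rw [ContinuousMulEquiv.symm_apply_apply]

include ha in
/-- **`hstab`**: vertex stabilisers in `Gqs L v` are open (★ FILE P through `eA`). [cite: BruhatTits1972, §10] [cite: SchneiderStuhler1997, Ch. I §2] -/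
theorem isOpen_setOf_actionHom_apply_eq (x : {M : Submodule 𝒪[(w.1.adicCompletion L)] (Fin 3 → (w.1.adicCompletion L)) // IsVertex (galAdicCompletionMap (L := L) (IsCMField.complexConj L) hw) ϖ ((StdForm.antidiagonal 3).over (w.1.adicCompletion L)) M}) : IsOpen {g : Gqs L v | a g x = x} := by
  have hset : {g : Gqs L v | a g x = x} = (eA : Gqs L v → ↥(unitaryGroupOfForm (galAdicCompletionMap (L := L) (IsCMField.complexConj L) hw) ((StdForm.antidiagonal 3).over (w.1.adicCompletion L)))) ⁻¹' {u | latticeGraphIso (galAdicCompletionMap (L := L) (IsCMField.complexConj L) hw) ϖ ((StdForm.antidiagonal 3).over (w.1.adicCompletion L)) u x = x} := by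
    ext g; simp only [Set.mem_setOf_eq, Set.mem_preimage, ha]
  rw [hset]
  exact (isOpen_setOf_latticeGraphIso_apply_eq (galAdicCompletionMap (L := L) (IsCMField.complexConj L) hw) ϖ ((StdForm.antidiagonal 3).over (w.1.adicCompletion L)) x).preimage eA.continuous

include hU in
/-- **`hUo`**: `U x` is open. [cite: SchneiderStuhler1997, Ch. I §2 (U1)] -/
theorem isOpen_coe_unitaryLevel_gqs (hd : UnramifiedLocalConjDatum (galAdicCompletionMap (L := L) (IsCMField.complexConj L) hw) ϖ) (x : {M : Submodule 𝒪[(w.1.adicCompletion L)] (Fin 3 → (w.1.adicCompletion L)) // IsVertex (galAdicCompletionMap (L := L) (IsCMField.complexConj L) hw) ϖ ((StdForm.antidiagonal 3).over (w.1.adicCompletion L)) M}) : IsOpen (U x : Set (Gqs L v)) := by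
  have hc0 : ϖ ^ (e + 1) ≠ 0 := pow_ne_zero _ (CartanUnique.uniformizer_ne_zero hd.vϖ)
  have hc1 : Valued.v (ϖ ^ (e + 1)) < 1 := by
    rw [CartanUnique.v_uniformizer_pow hd.vϖ, ← WithZero.exp_zero, WithZero.exp_lt_exp]; omega
  rw [unitaryLevel_eq_comap_map (eA := eA) (U := U) x]
  exact isOpen_coe_comap eA _ (isOpen_coe_unitaryLevel (map_unitaryLevel_mem_iff hU) hc0 hc1 x)

include hU in
/-- **`hUc`**: `U x` is compact (`𝒪_w` compact, `σ_w` continuous). [cite: SchneiderStuhler1997, Ch. I §2 (U1)] [cite: BruhatTits1972, §10] -/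
theorem isCompact_coe_unitaryLevel_gqs (hd : UnramifiedLocalConjDatum (galAdicCompletionMap (L := L) (IsCMField.complexConj L) hw) ϖ) (x : {M : Submodule 𝒪[(w.1.adicCompletion L)] (Fin 3 → (w.1.adicCompletion L)) // IsVertex (galAdicCompletionMap (L := L) (IsCMField.complexConj L) hw) ϖ ((StdForm.antidiagonal 3).over (w.1.adicCompletion L)) M}) : IsCompact (U x : Set (Gqs L v)) := by
  haveI := compactSpace_integer_adicCompletion L w.1
  have hσc : Continuous (galAdicCompletionMap (L := L) (IsCMField.complexConj L) hw) := continuous_galAdicCompletionMap L (IsCMField.complexConj L) hw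
  have hc0 : ϖ ^ (e + 1) ≠ 0 := pow_ne_zero _ (CartanUnique.uniformizer_ne_zero hd.vϖ)
  have hc1 : Valued.v (ϖ ^ (e + 1)) < 1 := by
    rw [CartanUnique.v_uniformizer_pow hd.vϖ, ← WithZero.exp_zero, WithZero.exp_lt_exp]; omega
  rw [unitaryLevel_eq_comap_map (eA := eA) (U := U) x]
  exact isCompact_coe_comap eA _ (isCompact_coe_unitaryLevel (map_unitaryLevel_mem_iff hU) hσc hc0 hc1 x)

include hU in
/-- **`hU6`** AT THE DATUM: `↑(U x ⊔ U y) = ↑(U x) * ↑(U y)` for adjacent vertices (★ FILE P `coe_sup_unitaryLevel_eq_mul_of_adj` through `eA`). [cite: SchneiderStuhler1997, Ch. I §2 (U6)] -/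
theorem coe_sup_unitaryLevel_gqs_eq_mul_of_adj (hd : UnramifiedLocalConjDatum (galAdicCompletionMap (L := L) (IsCMField.complexConj L) hw) ϖ) {x y : {M : Submodule 𝒪[(w.1.adicCompletion L)] (Fin 3 → (w.1.adicCompletion L)) // IsVertex (galAdicCompletionMap (L := L) (IsCMField.complexConj L) hw) ϖ ((StdForm.antidiagonal 3).over (w.1.adicCompletion L)) M}} (hxy : (latticeGraph (galAdicCompletionMap (L := L) (IsCMField.complexConj L) hw) ϖ ((StdForm.antidiagonal 3).over (w.1.adicCompletion L))).Adj x y) :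
    ((U x ⊔ U y : Subgroup (Gqs L v)) : Set (Gqs L v)) = (U x : Set (Gqs L v)) * (U y : Set (Gqs L v)) := by
  rw [unitaryLevel_eq_comap_map (eA := eA) (U := U) x, unitaryLevel_eq_comap_map (eA := eA) (U := U) y]
  exact coe_sup_comap_eq_mul eA (coe_sup_unitaryLevel_eq_mul_of_adj (map_unitaryLevel_mem_iff hU) hd hxy)

include hU in
/-- **`hU7`** AT THE DATUM (★ δ through `eA`): `G.Adj x y → dist y z + 1 = dist x z → ↑(U y) ⊆ ↑(U x) * ↑(U z)`. [cite: SchneiderStuhler1997, Prop. I.3.1] [cite: Korman2004, §3.6 (U7)] -/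
theorem coe_unitaryLevel_gqs_subset_mul_of_adj_of_dist (hd : UnramifiedLocalConjDatum (galAdicCompletionMap (L := L) (IsCMField.complexConj L) hw) ϖ) {x y z : {M : Submodule 𝒪[(w.1.adicCompletion L)] (Fin 3 → (w.1.adicCompletion L)) // IsVertex (galAdicCompletionMap (L := L) (IsCMField.complexConj L) hw) ϖ ((StdForm.antidiagonal 3).over (w.1.adicCompletion L)) M}} (hxy : (latticeGraph (galAdicCompletionMap (L := L) (IsCMField.complexConj L) hw) ϖ ((StdForm.antidiagonal 3).over (w.1.adicCompletion L))).Adj x y)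
    (hyz : (latticeGraph (galAdicCompletionMap (L := L) (IsCMField.complexConj L) hw) ϖ ((StdForm.antidiagonal 3).over (w.1.adicCompletion L))).dist y z + 1 = (latticeGraph (galAdicCompletionMap (L := L) (IsCMField.complexConj L) hw) ϖ ((StdForm.antidiagonal 3).over (w.1.adicCompletion L))).dist x z) :
    ((U y : Subgroup (Gqs L v)) : Set (Gqs L v)) ⊆ (U x : Set (Gqs L v)) * (U z : Set (Gqs L v)) := by
  have hc0 : ϖ ^ (e + 1) ≠ 0 := pow_ne_zero _ (CartanUnique.uniformizer_ne_zero hd.vϖ)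
  have hc1 : Valued.v (ϖ ^ (e + 1)) < 1 := by
    rw [CartanUnique.v_uniformizer_pow hd.vϖ, ← WithZero.exp_zero, WithZero.exp_lt_exp]; omega
  rw [unitaryLevel_eq_comap_map (eA := eA) (U := U) x, unitaryLevel_eq_comap_map (eA := eA) (U := U) y, unitaryLevel_eq_comap_map (eA := eA) (U := U) z]
  exact coe_comap_subset_mul eA (unitaryLevel_subset_mul_of_adj_of_dist_subtype (galAdicCompletionMap (L := L) (IsCMField.complexConj L) hw) hd hc0 hc1 rfl (fun x => (U x).map eA.toMonoidHom)
    (map_unitaryLevel_mem_iff hU) hxy hyz)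

include ha hU in
/-- **`hUa`** AT THE DATUM: `U (a g x) = (U x).map (conj g)`. [cite: SchneiderStuhler1997, Ch. I §2 (U3)] -/
theorem unitaryLevel_gqs_actionHom_eq_map_conj (g : Gqs L v) (x : {M : Submodule 𝒪[(w.1.adicCompletion L)] (Fin 3 → (w.1.adicCompletion L)) // IsVertex (galAdicCompletionMap (L := L) (IsCMField.complexConj L) hw) ϖ ((StdForm.antidiagonal 3).over (w.1.adicCompletion L)) M}) : U (a g x) = (U x).map (MulAut.conj g).toMonoidHom := by
  have h := unitaryLevel_latticeGraphIso_eq_map_conj (U := fun x => (U x).map eA.toMonoidHom) (map_unitaryLevel_mem_iff hU) (eA g) x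
  rw [unitaryLevel_eq_comap_map (eA := eA) (U := U) (a g x), ha, h, comap_map_conj, ← unitaryLevel_eq_comap_map (eA := eA) (U := U) x]

include hU in
/-- **`hEo`**: the edge group `U x ⊔ U y` is open. [cite: SchneiderStuhler1997, Ch. I §2 (U1)] -/
theorem isOpen_coe_sup_unitaryLevel_gqs (hd : UnramifiedLocalConjDatum (galAdicCompletionMap (L := L) (IsCMField.complexConj L) hw) ϖ) (x y : {M : Submodule 𝒪[(w.1.adicCompletion L)] (Fin 3 → (w.1.adicCompletion L)) // IsVertex (galAdicCompletionMap (L := L) (IsCMField.complexConj L) hw) ϖ ((StdForm.antidiagonal 3).over (w.1.adicCompletion L)) M}) : IsOpen ((U x ⊔ U y : Subgroup (Gqs L v)) : Set (Gqs L v)) :=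
  Subgroup.isOpen_mono le_sup_left (isOpen_coe_unitaryLevel_gqs hU hd x)

include hU in
/-- **`hEc`**: the edge group of an edge is compact. [cite: SchneiderStuhler1997, Ch. I §2 (U1)(U6)] -/
theorem isCompact_coe_sup_unitaryLevel_gqs_of_adj (hd : UnramifiedLocalConjDatum (galAdicCompletionMap (L := L) (IsCMField.complexConj L) hw) ϖ) {x y : {M : Submodule 𝒪[(w.1.adicCompletion L)] (Fin 3 → (w.1.adicCompletion L)) // IsVertex (galAdicCompletionMap (L := L) (IsCMField.complexConj L) hw) ϖ ((StdForm.antidiagonal 3).over (w.1.adicCompletion L)) M}} (hxy : (latticeGraph (galAdicCompletionMap (L := L) (IsCMField.complexConj L) hw) ϖ ((StdForm.antidiagonal 3).over (w.1.adicCompletion L))).Adj x y) :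
    IsCompact ((U x ⊔ U y : Subgroup (Gqs L v)) : Set (Gqs L v)) := by
  rw [coe_sup_unitaryLevel_gqs_eq_mul_of_adj hU hd hxy]
  exact (isCompact_coe_unitaryLevel_gqs hU hd x).mul (isCompact_coe_unitaryLevel_gqs hU hd y)

include ha hU in
/-- A member of `U x` fixes `x`. [cite: SchneiderStuhler1997, Ch. I §2 (U1)] -/
theorem actionHom_apply_eq_of_mem {g : Gqs L v} {x : {M : Submodule 𝒪[(w.1.adicCompletion L)] (Fin 3 → (w.1.adicCompletion L)) // IsVertex (galAdicCompletionMap (L := L) (IsCMField.complexConj L) hw) ϖ ((StdForm.antidiagonal 3).over (w.1.adicCompletion L)) M}} (hg : g ∈ U x) : a g x = x := by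
  rw [ha]
  exact latticeGraphIso_apply_eq_of_mem_unitaryLevel (map_unitaryLevel_mem_iff hU) (Subgroup.mem_map_of_mem eA.toMonoidHom hg)

include ha hU in
/-- **Level ≥ 1 fixes the closed star** at the datum (41f's `hKF`∕`hKN` once `K ≤ U x`): a member of `U x` fixes every neighbour of `x`. [cite: SchneiderStuhler1997, Ch. I §2 (U4)]
[cite: Korman2004, §9 Claim 39] -/
theorem actionHom_apply_eq_of_mem_of_adj (hd : UnramifiedLocalConjDatum (galAdicCompletionMap (L := L) (IsCMField.complexConj L) hw) ϖ) {g : Gqs L v} {x y : {M : Submodule 𝒪[(w.1.adicCompletion L)] (Fin 3 → (w.1.adicCompletion L)) // IsVertex (galAdicCompletionMap (L := L) (IsCMField.complexConj L) hw) ϖ ((StdForm.antidiagonal 3).over (w.1.adicCompletion L)) M}} (hg : g ∈ U x) (hxy : (latticeGraph (galAdicCompletionMap (L := L) (IsCMField.complexConj L) hw) ϖ ((StdForm.antidiagonal 3).over (w.1.adicCompletion L))).Adj x y) : a g y = y := by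
  rw [ha]
  exact latticeGraphIso_apply_eq_of_mem_unitaryLevel_of_adj (map_unitaryLevel_mem_iff hU) hd (Subgroup.mem_map_of_mem eA.toMonoidHom hg) hxy

include ha hU in
/-- An element fixing `x` normalises `U x`. [cite: SchneiderStuhler1997, Ch. I §2 (U3)] -/
theorem mem_normalizer_unitaryLevel_gqs_of_apply_eq {g : Gqs L v} {x : {M : Submodule 𝒪[(w.1.adicCompletion L)] (Fin 3 → (w.1.adicCompletion L)) // IsVertex (galAdicCompletionMap (L := L) (IsCMField.complexConj L) hw) ϖ ((StdForm.antidiagonal 3).over (w.1.adicCompletion L)) M}} (hx : a g x = x) : g ∈ Subgroup.normalizer ((U x : Subgroup (Gqs L v)) : Set (Gqs L v)) := by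
  rw [ha] at hx
  rw [unitaryLevel_eq_comap_map (eA := eA) (U := U) x]
  exact mem_normalizer_comap eA (mem_normalizer_unitaryLevel_of_apply_eq (map_unitaryLevel_mem_iff hU) hx)

end Datum

/-! ## §3 THE HEAD: (SS-K) uniform at the datum -/

section Head

variable (L : Type) [Field L] [NumberField L] [IsCMField L] (v : HeightOneSpectrum (𝓞 ↥(maximalRealSubfield L)))

set_option maxHeartbeats 1600000 in
/-- **(SS-K) UNIFORM AT THE DATUM** — the Schneider–Stuhler ∕ Korman character formula on the `U(Φ₃)(L⁺_v)` tree, density-free and truncation-free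
([SchneiderStuhler1997 Thm. III.4.16–17], [Korman2004 Thm. 40], [MeyerSolleveld2010 Prop. 4.1], census 38 (A13) @ datum; ★ 41f `levelTrace_eq_fixedVertexSum_sub_fixedEdgeSum` over
★ row 25 §1).  At a non-split unramified place `v` ((G3) letters `(w hw ϖ hd eA)`), for the action hom `a` and the unitary level family `U` at level `ϖ^(e+1)` (§2, hypothesis-style
`ha hU`, binders `hUo hUc hEo hEc`), a §12.5 datum `𝔇` with `𝔇.μG = νQv` Haar and `𝔇.char (IrrClass.mk r)` representing the character (`hrep`), a level with a non-zero fixed vector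
(`he`), and `γ` with non-empty finite fixed tree (`hne`, `hfin`, `hfinE`) at which the character is locally constant (`hHC`):
`𝔇.char (IrrClass.mk r) γ = Σ_{x ∈ X^γ⁰} tr(γ | π^{U_x}) − Σ_{d ∈ X^γ¹} tr(γ | π^{U_d})`.
[cite: SchneiderStuhler1997, Thm. III.4.16] [cite: Korman2004, Theorem 40] [cite: MeyerSolleveld2010, Prop. 4.1] [cite: Rogawski1990, §12.5 pp. 182–187] -/
theorem char_eq_fixedVertexSum_sub_fixedEdgeSum
    (hns : ∀ w : PlacesOver L v, IsCMField.complexConj L • w.1 = w.1)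
    (w : PlacesOver L v) (hw : IsCMField.complexConj L • w.1 = w.1) {ϖ : w.1.adicCompletion L} (hd : UnramifiedLocalConjDatum (galAdicCompletionMap (L := L) (IsCMField.complexConj L) hw) ϖ)
    (eA : Gqs L v ≃ₜ* ↥(unitaryGroupOfForm (galAdicCompletionMap (L := L) (IsCMField.complexConj L) hw) ((StdForm.antidiagonal 3).over (w.1.adicCompletion L))))
    [MeasurableSpace (Gqs L v)] [BorelSpace (Gqs L v)]
    [∀ γ : Gqs L v, MeasurableSpace (Gqs L v ⧸ Subgroup.centralizer ({γ} : Set (Gqs L v)))]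
    [MeasurableSpace (Gqs L v ⧸ Subgroup.center (Gqs L v))]
    {H : Type} [Group H] [TopologicalSpace H] [IsTopologicalGroup H] [MeasurableSpace H]
    (νQv : Measure (Gqs L v)) [νQv.IsHaarMeasure]
    (𝔇 : EllipticData (Gqs L v) H) (hμG : 𝔇.μG = νQv)
    (r : SmoothIrrep (Gqs L v))
    (hrep : ∀ φ : Gqs L v → ℂ, IsLocSmooth φ → (IrrClass.mk r).smoothTrace 𝔇.μG φ = ∫ x, φ x * 𝔇.char (IrrClass.mk r) x ∂𝔇.μG)
    {a : Gqs L v →* ((latticeGraph (galAdicCompletionMap (L := L) (IsCMField.complexConj L) hw) ϖ ((StdForm.antidiagonal 3).over (w.1.adicCompletion L))) ≃g (latticeGraph (galAdicCompletionMap (L := L) (IsCMField.complexConj L) hw) ϖ ((StdForm.antidiagonal 3).over (w.1.adicCompletion L))))} (ha : ∀ g, a g = latticeGraphIso (galAdicCompletionMap (L := L) (IsCMField.complexConj L) hw) ϖ ((StdForm.antidiagonal 3).over (w.1.adicCompletion L)) (eA g))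
    (τ : Orientation (latticeGraph (galAdicCompletionMap (L := L) (IsCMField.complexConj L) hw) ϖ ((StdForm.antidiagonal 3).over (w.1.adicCompletion L)))) (hτ : ∀ d, τ.tail d < τ.head d)
    {e : ℕ} {U : {M : Submodule 𝒪[(w.1.adicCompletion L)] (Fin 3 → (w.1.adicCompletion L)) // IsVertex (galAdicCompletionMap (L := L) (IsCMField.complexConj L) hw) ϖ ((StdForm.antidiagonal 3).over (w.1.adicCompletion L)) M} → Subgroup (Gqs L v)}
    (hU : ∀ x g, g ∈ U x ↔ mapGL ((eA g : ↥(unitaryGroupOfForm (galAdicCompletionMap (L := L) (IsCMField.complexConj L) hw) ((StdForm.antidiagonal 3).over (w.1.adicCompletion L)))) : GL (Fin 3) (w.1.adicCompletion L)) x.1 = x.1 ∧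
      x.1.map ((Matrix.toLin' ((((eA g : ↥(unitaryGroupOfForm (galAdicCompletionMap (L := L) (IsCMField.complexConj L) hw) ((StdForm.antidiagonal 3).over (w.1.adicCompletion L)))) : GL (Fin 3) (w.1.adicCompletion L)) : Matrix (Fin 3) (Fin 3) (w.1.adicCompletion L)) - 1)).restrictScalars 𝒪[(w.1.adicCompletion L)]) ≤ scaleLattice (ϖ ^ (e + 1)) x.1)
    (hUo : ∀ x, IsOpen (U x : Set (Gqs L v))) (hUc : ∀ x, IsCompact (U x : Set (Gqs L v)))
    (hEo : ∀ d : (latticeGraph (galAdicCompletionMap (L := L) (IsCMField.complexConj L) hw) ϖ ((StdForm.antidiagonal 3).over (w.1.adicCompletion L))).edgeSet, IsOpen ((U (τ.head d) ⊔ U (τ.tail d) : Subgroup (Gqs L v)) : Set (Gqs L v)))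
    (hEc : ∀ d : (latticeGraph (galAdicCompletionMap (L := L) (IsCMField.complexConj L) hw) ϖ ((StdForm.antidiagonal 3).over (w.1.adicCompletion L))).edgeSet, IsCompact ((U (τ.head d) ⊔ U (τ.tail d) : Subgroup (Gqs L v)) : Set (Gqs L v)))
    (he : ∃ x₀ : {M : Submodule 𝒪[(w.1.adicCompletion L)] (Fin 3 → (w.1.adicCompletion L)) // IsVertex (galAdicCompletionMap (L := L) (IsCMField.complexConj L) hw) ϖ ((StdForm.antidiagonal 3).over (w.1.adicCompletion L)) M}, r.ρ.fixedPoints (U x₀) ≠ ⊥)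
    {γ : Gqs L v} (hne : ∃ o, a γ o = o) (hfin : {x : {M : Submodule 𝒪[(w.1.adicCompletion L)] (Fin 3 → (w.1.adicCompletion L)) // IsVertex (galAdicCompletionMap (L := L) (IsCMField.complexConj L) hw) ϖ ((StdForm.antidiagonal 3).over (w.1.adicCompletion L)) M} | a γ x = x}.Finite) (hfinE : {d : (latticeGraph (galAdicCompletionMap (L := L) (IsCMField.complexConj L) hw) ϖ ((StdForm.antidiagonal 3).over (w.1.adicCompletion L))).edgeSet | (a γ).mapEdgeSet d = d}.Finite)
    (hHC : ∀ᶠ g in nhds γ, 𝔇.char (IrrClass.mk r) g = 𝔇.char (IrrClass.mk r) γ) :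
    𝔇.char (IrrClass.mk r) γ =
      (∑ x ∈ hfin.toFinset, r.ρ.levelTrace (hUo x) (hUc x) γ) - ∑ d ∈ hfinE.toFinset, r.ρ.levelTrace (hEo d) (hEc d) γ := by
  classical
  haveI : r.ρ.IsIrreducible := r.isIrreducible
  haveI : NonarchimedeanGroup (Gqs L v) :=
    nonarchimedeanGroup_unitaryGroupOfForm_local (E := L) (c := IsCMField.complexConj L) (N := 3) (v := v) (J' := (adelicForm L 3 (qsForm L)).map (adeleToLocal L v))
  have hT := isTree_latticeGraph_three_of_unramified hd
  have hconn := hT.1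
  have hloc := fun x : {M : Submodule 𝒪[(w.1.adicCompletion L)] (Fin 3 → (w.1.adicCompletion L)) // IsVertex (galAdicCompletionMap (L := L) (IsCMField.complexConj L) hw) ϖ ((StdForm.antidiagonal 3).over (w.1.adicCompletion L)) M} => UnitaryLatticeTree.finite_neighborSet_inert (E := L) (c := IsCMField.complexConj L) (v := v) w hw hd x
  have hadm : r.ρ.IsAdmissible := F0P3cStCharTSScTracePackage.isAdmissible_smoothIrrep L v hns r
  have hσa : ∀ (g : Gqs L v) (d : (latticeGraph (galAdicCompletionMap (L := L) (IsCMField.complexConj L) hw) ϖ ((StdForm.antidiagonal 3).over (w.1.adicCompletion L))).edgeSet), τ.head ((a g).mapEdgeSet d) = a g (τ.head d) ∧ τ.tail ((a g).mapEdgeSet d) = a g (τ.tail d) := fun g d => by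
    rw [ha]; exact head_mapEdgeSet_latticeGraphIso (galAdicCompletionMap (L := L) (IsCMField.complexConj L) hw) ϖ ((StdForm.antidiagonal 3).over (w.1.adicCompletion L)) hτ (eA g) d
  -- the base vertex `o ∈ X^γ` and its stabiliser `P`
  obtain ⟨o, ho⟩ := hne
  obtain ⟨P₀, hP₀⟩ := exists_stabilizerSubgroup (galAdicCompletionMap (L := L) (IsCMField.complexConj L) hw) ϖ ((StdForm.antidiagonal 3).over (w.1.adicCompletion L)) o
  have hPmem : ∀ g : Gqs L v, g ∈ P₀.comap eA.toMonoidHom ↔ a g o = o := fun g => by rw [mem_comap_iff', hP₀, ha]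
  have hPo : IsOpen ((P₀.comap eA.toMonoidHom : Subgroup (Gqs L v)) : Set (Gqs L v)) := by
    have hset : ((P₀.comap eA.toMonoidHom : Subgroup (Gqs L v)) : Set (Gqs L v)) = {g : Gqs L v | a g o = o} := Set.ext hPmem
    rw [hset]; exact isOpen_setOf_actionHom_apply_eq ha o
  have hPc : IsCompact ((P₀.comap eA.toMonoidHom : Subgroup (Gqs L v)) : Set (Gqs L v)) := by
    haveI := compactSpace_integer_adicCompletion L w.1
    have hset : (P₀ : Set ↥(unitaryGroupOfForm (galAdicCompletionMap (L := L) (IsCMField.complexConj L) hw) ((StdForm.antidiagonal 3).over (w.1.adicCompletion L)))) = {u | latticeGraphIso (galAdicCompletionMap (L := L) (IsCMField.complexConj L) hw) ϖ ((StdForm.antidiagonal 3).over (w.1.adicCompletion L)) u o = o} := Set.ext hP₀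
    refine isCompact_coe_comap eA P₀ ?_
    rw [hset]
    exact isCompact_setOf_latticeGraphIso_apply_eq (galAdicCompletionMap (L := L) (IsCMField.complexConj L) hw) ϖ ((StdForm.antidiagonal 3).over (w.1.adicCompletion L)) (continuous_galAdicCompletionMap L (IsCMField.complexConj L) hw) o
  have hγP : γ ∈ P₀.comap eA.toMonoidHom := (hPmem γ).2 ho
  -- the auxiliary group `K` (★ 41c, Korman Claim 39)
  obtain ⟨K, hKo, hKc, hKP, hKU₀, hKγ, hKΘ, hKn⟩ := Subgroup.exists_aux_subgroup_of_eventually_eq_finset (P₀.comap eA.toMonoidHom) hPo hPc hγP U hfin.toFinset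
    (fun x _ => hUo x) hHC
  have hγK : γ ∈ Subgroup.normalizer (K : Set (Gqs L v)) := by
    rw [Subgroup.mem_normalizer_iff]
    intro c
    constructor
    · exact hKγ c
    · intro hc
      have h := hKn γ⁻¹ (Subgroup.inv_mem _ hγP) _ hc
      rwa [inv_inv, ← mul_assoc, ← mul_assoc, inv_mul_cancel, one_mul, inv_mul_cancel_right] at h
  have hKUfix : ∀ x, a γ x = x → K ≤ U x := fun x hx => hKU₀ x (hfin.mem_toFinset.2 hx)
  -- generation at level `e` (★ row 23) and the finite carrier of `V^K` (★ 41c)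
  have hgen : ⨆ x, r.ρ.fixedPoints (U x) = ⊤ := by
    obtain ⟨x₀, hx₀⟩ := he
    refine top_le_iff.1 ?_
    rw [← r.ρ.iSup_fixedPoints_map_conj_eq_top (U x₀) hx₀]
    refine iSup_le fun g => ?_
    rw [← unitaryLevel_gqs_actionHom_eq_map_conj ha hU g x₀]
    exact le_iSup (fun x => r.ρ.fixedPoints (U x)) _
  obtain ⟨S₀, hS₀⟩ := r.ρ.exists_finset_fixedPoints_le_biSup_of_isAdmissible hadm ⟨K, hKo⟩ hKc U hgen
  -- the ball `S = B(o, R)` containing `X^γ⁰` and `S₀`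
  obtain ⟨R, hR⟩ := ClosedBall.exists_subset_setOf_dist_le (G := (latticeGraph (galAdicCompletionMap (L := L) (IsCMField.complexConj L) hw) ϖ ((StdForm.antidiagonal 3).over (w.1.adicCompletion L)))) (hfin.union S₀.finite_toSet) o
  have hS : {x : {M : Submodule 𝒪[(w.1.adicCompletion L)] (Fin 3 → (w.1.adicCompletion L)) // IsVertex (galAdicCompletionMap (L := L) (IsCMField.complexConj L) hw) ϖ ((StdForm.antidiagonal 3).over (w.1.adicCompletion L)) M} | (latticeGraph (galAdicCompletionMap (L := L) (IsCMField.complexConj L) hw) ϖ ((StdForm.antidiagonal 3).over (w.1.adicCompletion L))).dist o x ≤ R}.Finite := ClosedBall.finite_setOf_dist_le hloc hconn o R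
  have hfixS : ∀ x, a γ x = x → x ∈ {x : {M : Submodule 𝒪[(w.1.adicCompletion L)] (Fin 3 → (w.1.adicCompletion L)) // IsVertex (galAdicCompletionMap (L := L) (IsCMField.complexConj L) hw) ϖ ((StdForm.antidiagonal 3).over (w.1.adicCompletion L)) M} | (latticeGraph (galAdicCompletionMap (L := L) (IsCMField.complexConj L) hw) ϖ ((StdForm.antidiagonal 3).over (w.1.adicCompletion L))).dist o x ≤ R} := fun x hx => hR (Or.inl hx)
  have hS₀S : ∀ x ∈ S₀, x ∈ {x : {M : Submodule 𝒪[(w.1.adicCompletion L)] (Fin 3 → (w.1.adicCompletion L)) // IsVertex (galAdicCompletionMap (L := L) (IsCMField.complexConj L) hw) ϖ ((StdForm.antidiagonal 3).over (w.1.adicCompletion L)) M} | (latticeGraph (galAdicCompletionMap (L := L) (IsCMField.complexConj L) hw) ϖ ((StdForm.antidiagonal 3).over (w.1.adicCompletion L))).dist o x ≤ R} := fun x hx => hR (Or.inr hx)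
  have hP : ∀ g ∈ P₀.comap eA.toMonoidHom, ∀ x, a g x ∈ {x : {M : Submodule 𝒪[(w.1.adicCompletion L)] (Fin 3 → (w.1.adicCompletion L)) // IsVertex (galAdicCompletionMap (L := L) (IsCMField.complexConj L) hw) ϖ ((StdForm.antidiagonal 3).over (w.1.adicCompletion L)) M} | (latticeGraph (galAdicCompletionMap (L := L) (IsCMField.complexConj L) hw) ϖ ((StdForm.antidiagonal 3).over (w.1.adicCompletion L))).dist o x ≤ R} ↔ x ∈ {x : {M : Submodule 𝒪[(w.1.adicCompletion L)] (Fin 3 → (w.1.adicCompletion L)) // IsVertex (galAdicCompletionMap (L := L) (IsCMField.complexConj L) hw) ϖ ((StdForm.antidiagonal 3).over (w.1.adicCompletion L)) M} | (latticeGraph (galAdicCompletionMap (L := L) (IsCMField.complexConj L) hw) ϖ ((StdForm.antidiagonal 3).over (w.1.adicCompletion L))).dist o x ≤ R} :=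
    fun g hg x => ClosedBall.apply_mem_setOf_dist_le_iff (a g) ((hPmem g).1 hg) R x
  have hfd : ∀ x ∈ {x : {M : Submodule 𝒪[(w.1.adicCompletion L)] (Fin 3 → (w.1.adicCompletion L)) // IsVertex (galAdicCompletionMap (L := L) (IsCMField.complexConj L) hw) ϖ ((StdForm.antidiagonal 3).over (w.1.adicCompletion L)) M} | (latticeGraph (galAdicCompletionMap (L := L) (IsCMField.complexConj L) hw) ϖ ((StdForm.antidiagonal 3).over (w.1.adicCompletion L))).dist o x ≤ R}, FiniteDimensional ℂ (r.ρ.fixedPoints (U x)) := fun x _ => hadm.finite_fixedPoints ⟨U x, hUo x⟩ (hUc x)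
  have hKV : r.ρ.fixedPoints K ≤ ⨆ x ∈ {x : {M : Submodule 𝒪[(w.1.adicCompletion L)] (Fin 3 → (w.1.adicCompletion L)) // IsVertex (galAdicCompletionMap (L := L) (IsCMField.complexConj L) hw) ϖ ((StdForm.antidiagonal 3).over (w.1.adicCompletion L)) M} | (latticeGraph (galAdicCompletionMap (L := L) (IsCMField.complexConj L) hw) ϖ ((StdForm.antidiagonal 3).over (w.1.adicCompletion L))).dist o x ≤ R}, r.ρ.fixedPoints (U x) :=
    hS₀.trans (iSup₂_le fun x hx => le_biSup (fun x => r.ρ.fixedPoints (U x)) (hS₀S x hx))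
  -- ★ 41f on the ball
  have h41f := Representation.levelTrace_eq_fixedVertexSum_sub_fixedEdgeSum (ρ := r.ρ) hT τ hσa (isOpen_setOf_actionHom_apply_eq ha) U hUo hUc
    (fun x y hxy => coe_sup_unitaryLevel_gqs_eq_mul_of_adj hU hd hxy) (fun x y z hxy hyz => coe_unitaryLevel_gqs_subset_mul_of_adj_of_dist hU hd hxy hyz)
    (unitaryLevel_gqs_actionHom_eq_map_conj ha hU) hEo hEc hadm.isSmooth hS (r := o) (ClosedBall.setOf_dist_le_rootClosed o R) hfd hP hγP ⟨o, ho⟩ hKo hKc hKP hγK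
    (fun x _ hx => hKUfix x hx) (fun c hc x hx => actionHom_apply_eq_of_mem ha hU (hKUfix x hx hc))
    (fun c hc x y hx hxy => actionHom_apply_eq_of_mem_of_adj ha hU hd (hKUfix x hx hc) hxy) hKV
  -- the character as a level trace (★ row 25 §1 + ★ TRACE-COSET)
  have hchar : 𝔇.char (IrrClass.mk r) γ = r.ρ.levelTrace hKo hKc γ := by
    rw [F0P3cStCharTSKormanRemarkEight.char_eq_trace_fixedPoints_of_constOn_coset L v hns νQv 𝔇 hμG r hrep hKo hKc hγK hKΘ,
      r.ρ.levelTrace_eq_trace_restrict_of_mem_normalizer hKo hKc hγK]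
  -- the `S`-filtered sums are the sums over the fixed sets
  have hV : hS.toFinset.filter (fun x => a γ x = x) = hfin.toFinset := by
    ext x
    simp only [Finset.mem_filter, Set.Finite.mem_toFinset, Set.mem_setOf_eq]
    exact ⟨fun h => h.2, fun h => ⟨hfixS x h, h⟩⟩
  have hE' : (Representation.finite_edges_of_finite τ hS).toFinset.filter (fun d => (a γ).mapEdgeSet d = d) = hfinE.toFinset := by
    ext d
    simp only [Finset.mem_filter, Set.Finite.mem_toFinset, Set.mem_setOf_eq]
    refine ⟨fun h => h.2, fun h => ⟨?_, h⟩⟩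
    obtain ⟨hh, ht⟩ := (hσa γ d)
    rw [h] at hh ht
    exact ⟨hfixS _ hh.symm, hfixS _ ht.symm⟩
  rw [hchar, h41f, hV, hE']

end Head

end Summit.HodgeConjecture.HodgeConjecture.Cruxes.H413.F0P3cStCharTSCharacterEllipticUniform

end
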